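import Summits.AtomisticToContinuum.HydrodynamicLimit.Theses.StiffCollisionalRelaxation
import Summits.AtomisticToContinuum.HydrodynamicLimit.Theorems.CollisionIsometryCLTCollisionalTransferLocalityDefs

/-!
# Skeleton for the crux `FastMomentRelaxation` (stmt-AtomisticToContinuum-9522), line `birth` — rev 2 (lead reshape)

Route `StiffCollisionalRelaxation` (`Summits/AtomisticToContinuum/HydrodynamicLimit/Theses/StiffCollisionalRelaxation.lean`,
decl `FastMomentRelaxation`, L503; `CollisionIsometryCLT.FastMomentRelaxation` is the same text). The crux,
read back: for all continuous positive local-Gibbs profiles `∃ σ₀ ∀ 0 < σ < σ₀`, for every hard-sphere flow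
family `Φ N`, every mesoscopic exponent `0 < γ ≤ 1/15` and every admissible kernel family `φ_N`, for every
`t > 0` and `δ > 0`, `P_N( δ < ∫₀ᵗ ∫_{𝕋³} (Σ_{jk} D_{jk}² + |q|²) dx ds ) → 0`, where `D` is the block
traceless CENTRAL kinetic stress and `q` the block kinetic heat flux of `Φ_N(s) z`, centred at `ū = m̄/ρ̄`.

## rev 2 (lead prover, 2026-08-17): the same three stubs, stated LET-FREE

The birth skeleton (planner-skel, sha 4dfe9a28…) stated each stub with the crux's `let ρb := …; let mb := …;
let ub := …; let D := …; let q := …` telescope inside the signature; the ledger truncates registered stub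
signatures at the first ` := ` (skeleton-vet SKELVET.md caveat: 836/864/864 chars registered vs 2634/2103/1934
in file — the registered signatures did not elaborate). rev 2 states the three stubs over the IMPORTABLE
vocabulary of `Theorems/CollisionIsometryCLTCollisionalTransferLocalityDefs.lean`
(namespace `…Theorems.HemisphereAffineSlaving`: `Cfg`, `Flows`, `AdmissibleKernel`, and the block fields
`rhoB, mB, uB, Dst, qfl` whose bodies are byte-for-byte the crux's `let`s), so that (a) each registered
signature is a closed, elaborating term with no `let`, (b) each stub lands in its own Theorems file with
the registered signature verbatim, and (c) the provable stub can use the landed block-field toolkit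
`Theorems/CollisionIsometryCLTCollisionalTransferLocalityBlockFields.lean` (`measurable_kineticIntegrand`,
`abs_Dst_le`, `norm_qfl_le`, `measurable_orbit`, `norm_vel_orbit_le`, `localGibbsLaw_compl_good'`).
The composition `FastMomentRelaxation_of` still concludes the ROUTE DECL BY NAME: after `intro` of the
crux's `let`-bound block fields the two vocabularies agree definitionally (ζ/δ-unfolding), which the
kernel checks in the final `exact`.

* `stub_blockFluxRegularity` — ORBIT REGULARITY OF THE BLOCK FLUXES (true, S/M, provable now; rev 2 drops
  the idle hypotheses: only continuity and nonnegativity of the kernel slice `φ N` are used, no `σ₀`, no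
  profile positivity): for every `N`, for `localGibbsLaw`-a.e. `z`, `x ↦ Σ D²` and `x ↦ |q|²` of `Φ_N(s) z`
  are integrable on `𝕋³` for every `s ∈ [0,t]`, and `s ↦ ∫ₓ Σ D²`, `s ↦ ∫ₓ |q|²` are integrable on `[0,t]`.
  Mechanism: the law is `liouville.withDensity _`, so the flow's bad set is null (`localGibbsLaw_compl_good'`);
  on a good orbit speeds are bounded by `√(2E(z))` (energy conservation, `norm_vel_orbit_le`) and the orbit is
  measurable in time (`measurable_orbit`); the integrands are measurable in `(z, x)` and bounded by
  `kineticIntegrand_le`-type bounds; `𝕋³` and `[0,t]` have finite measure.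
* `stub_stressDeviatorRelaxation` — SECOND-MOMENT ISOTROPISATION (OPEN, XL): `P_N(δ < ∫₀ᵗ∫ Σ D²) → 0` with the
  crux's prefix (its own `σ₀`), kernel hypothesis folded as `AdmissibleKernel γ C φ` (verbatim conjunction).
* `stub_kineticHeatFluxRelaxation` — THIRD-MOMENT (HEAT-FLUX) RELAXATION (OPEN, XL; the HARDEST stub):
  `P_N(δ < ∫₀ᵗ∫ |q|²) → 0`, same prefix. `|q|²` is a sixth velocity moment along the deterministic dynamics
  (HighMomentumCutoff barrier; OVY93 modify the kinetic energy to kill exactly this channel) and the channel of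
  the free-gas counterexample at `σ = 0` (`Literature.Barriers.AtomisticToContinuum.BoltzmannHypothesisBarrierNarrow`
  kernel (5)).

Composition `FastMomentRelaxation_of (h₁ h₂ h₃) : …Theses.StiffCollisionalRelaxation.FastMomentRelaxation`
(hypotheses = the registered stub statements BY NAME; kernel-checked, no `sorry`): `σ₀ := min σ₀ᴰ σ₀^q`; for
fixed `t, δ` the crux event lies in `{δ/2 < ∫∫ΣD²} ∪ {δ/2 < ∫∫|q|²} ∪ {orbit not regular}` (on a regular orbit
the iterated Bochner integral is additive), the third event is `P_N`-null, union bound and squeeze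
(`tendsto_measure_sumEvent_of_channels`, unchanged from rev 1).

Equilibrium rung already in the tree (not used here, recorded for the census): at CONSTANT profiles
`(1, θ, 0)` the crux's conclusion is PROVED for all `0 < σ ≤ 1/2`
(`Theorems/CollisionIsometryCLTCollisionalTransferLocalityFmrRung0.lean`, `fmr_rung0` / `fmrAt_const`:
the local Gibbs law is then the invariant Gibbs measure and the statics CLT floors vanish). The two dynamical
stubs are the NON-equilibrium content and are each the crux restricted to one channel — `birth` is a
bookkeeping split, not a reduction (said up front in PICKED.md).
Disproof used: none (no `Disproof.lean` for this crux at 2026-08-17T18Z). Sources: Grad1949;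
IkenberryTruesdell1956; Spohn1991 Part I Ch. 3 §3.2; OllaVaradhanYau1993 §1; ChenLevermoreLiu1994; Levermore1996.
-/

noncomputable section

open MeasureTheory Set Filter Topology
open scoped ENNReal BigOperators

open Literature.MathematicalPhysics.KineticTheory (T3 V3 localGibbsLaw)
open Summit.AtomisticToContinuum.HydrodynamicLimit.Theorems.HemisphereAffineSlaving
  (Cfg Flows AdmissibleKernel rhoB mB uB Dst qfl)

namespace Summit.AtomisticToContinuum.HydrodynamicLimit.Cruxes.FastMomentRelaxation.Birth

/-! ## The registered stubs (sorried theorems in `Holds`, statements by name below, composition `_of`) -/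

namespace Holds

/-- **Stub 1 (regularity; true, S/M, provable now).** ORBIT REGULARITY OF THE BLOCK KINETIC FLUXES, let-free
over the `HemisphereAffineSlaving` vocabulary: for any `σ`, any flow family `Φ`, any kernel family `φ` whose
slice `φ N` is continuous and nonnegative, any profiles and any horizon `t`, for `localGibbsLaw`-a.e. `z` the
maps `x ↦ Σ_{jk} Dst φ N (Φ_N(s) z) x j k ²` and `x ↦ ‖qfl φ N (Φ_N(s) z) x‖²` are integrable on `𝕋³` for
every `s ∈ [0,t]`, and their space integrals are integrable in `s` on `[0,t]`. Toolkit: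
`Theorems/CollisionIsometryCLTCollisionalTransferLocalityBlockFields.lean`. -/
theorem stub_blockFluxRegularity :
    ∀ (σ : ℝ) (Φ : Flows σ) (φ : ℕ → T3 → ℝ) (N : ℕ), Continuous (φ N) → (∀ y, 0 ≤ φ N y) → ∀ (a₀ θ₀ : T3 → ℝ) (u₀ : T3 → V3) (t : ℝ), ∀ᵐ z ∂(localGibbsLaw σ a₀ u₀ θ₀ N (Φ N)), (∀ s ∈ Icc 0 t, Integrable (fun x : T3 => ∑ j, ∑ k, Dst φ N ((Φ N).flow s z) x j k ^ 2)) ∧ (∀ s ∈ Icc 0 t, Integrable (fun x : T3 => ‖qfl φ N ((Φ N).flow s z) x‖ ^ 2)) ∧ IntegrableOn (fun s : ℝ => ∫ x, ∑ j, ∑ k, Dst φ N ((Φ N).flow s z) x j k ^ 2) (Icc 0 t) ∧ IntegrableOn (fun s : ℝ => ∫ x, ‖qfl φ N ((Φ N).flow s z) x‖ ^ 2) (Icc 0 t) := by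
  sorry

/-- **Stub 2 (dynamical; OPEN, XL).** STRESS-DEVIATOR (SECOND-MOMENT) RELAXATION, let-free: with the crux's
prefix verbatim (its own `σ₀`; kernel hypothesis = `AdmissibleKernel γ C φ`, the crux's conjunction), for
every `t > 0` and `δ > 0`, `P_N(δ < ∫₀ᵗ∫_{𝕋³} Σ_{jk} (Dst φ N (Φ_N(s) z) x j k)² dx ds) → 0`. Why it might fail:
persistent counter-streaming at scales `≫ (N+1)^{-γ}`; no producer in hand (the weighted coercivity (‡) was
retired by refuters g41-6 / rreview-0815T13-23,-26). It is the crux restricted to the D-channel. -/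
theorem stub_stressDeviatorRelaxation :
    ∀ (a₀ θ₀ : T3 → ℝ) (u₀ : T3 → V3), Continuous a₀ → Continuous θ₀ → Continuous u₀ → (∀ x, 0 < a₀ x) → (∀ x, 0 < θ₀ x) → ∃ σ₀ : ℝ, 0 < σ₀ ∧ ∀ σ : ℝ, 0 < σ → σ < σ₀ → ∀ Φ : Flows σ, ∀ (γ C : ℝ) (φ : ℕ → T3 → ℝ), 0 < γ → γ ≤ 1 / 15 → AdmissibleKernel γ C φ → ∀ t : ℝ, 0 < t → ∀ δ : ℝ, 0 < δ → Tendsto (fun N : ℕ => localGibbsLaw σ a₀ u₀ θ₀ N (Φ N) {z | δ < ∫ s in Icc 0 t, ∫ x, ∑ j, ∑ k, Dst φ N ((Φ N).flow s z) x j k ^ 2}) atTop (𝓝 0) := by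
  sorry

/-- **Stub 3 (dynamical; OPEN, XL — the hardest, load-bearing stub).** KINETIC HEAT-FLUX (THIRD-MOMENT)
RELAXATION, let-free: with the crux's prefix verbatim, for every `t > 0` and `δ > 0`,
`P_N(δ < ∫₀ᵗ∫_{𝕋³} ‖qfl φ N (Φ_N(s) z) x‖² dx ds) → 0`. Why it might fail: `|q|²` is a sixth velocity moment
along the deterministic dynamics (HighMomentumCutoff barrier: no a-priori fast-particle estimate at fixed
reduced density; OVY93 modify the kinetic energy to avoid exactly this), and at `σ = 0` the statement is false
(free gas with a rest-frame heat current). It is the crux restricted to the q-channel. -/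
theorem stub_kineticHeatFluxRelaxation :
    ∀ (a₀ θ₀ : T3 → ℝ) (u₀ : T3 → V3), Continuous a₀ → Continuous θ₀ → Continuous u₀ → (∀ x, 0 < a₀ x) → (∀ x, 0 < θ₀ x) → ∃ σ₀ : ℝ, 0 < σ₀ ∧ ∀ σ : ℝ, 0 < σ → σ < σ₀ → ∀ Φ : Flows σ, ∀ (γ C : ℝ) (φ : ℕ → T3 → ℝ), 0 < γ → γ ≤ 1 / 15 → AdmissibleKernel γ C φ → ∀ t : ℝ, 0 < t → ∀ δ : ℝ, 0 < δ → Tendsto (fun N : ℕ => localGibbsLaw σ a₀ u₀ θ₀ N (Φ N) {z | δ < ∫ s in Icc 0 t, ∫ x, ‖qfl φ N ((Φ N).flow s z) x‖ ^ 2}) atTop (𝓝 0) := by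
  sorry

end Holds

/-! ## The stub statements by name (hypotheses of `FastMomentRelaxation_of`) -/

/-- Statement of `Holds.stub_blockFluxRegularity` (registered stub 1, regularity). -/
def stub_blockFluxRegularity : Prop := type_of% Holds.stub_blockFluxRegularity

/-- Statement of `Holds.stub_stressDeviatorRelaxation` (registered stub 2, second-moment channel). -/
def stub_stressDeviatorRelaxation : Prop := type_of% Holds.stub_stressDeviatorRelaxation

/-- Statement of `Holds.stub_kineticHeatFluxRelaxation` (registered stub 3, third-moment channel, hardest). -/
def stub_kineticHeatFluxRelaxation : Prop := type_of% Holds.stub_kineticHeatFluxRelaxation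

/-! ## Proved glue: two channels in probability + a.e. regularity ⇒ the summed `L²_{t,x}` event -/

/-- **Channel splitting under a sequence of laws** (pure measure theory, sorry-free). For laws `P N`
on `N`-dependent spaces, two space–time integrands `f N z, g N z : ℝ → X → ℝ`, a horizon `t` and
`δ > 0`: if for `P N`-a.e. `z` both integrands are `x`-integrable for every `s ∈ [0,t]` with
`s`-integrable space integrals on `[0,t]`, and each channel's iterated integral exceeds any `δ' > 0`
with probability `→ 0`, then `P N (δ < ∫_{[0,t]} ∫ (f + g)) → 0`. Proof: on a regular `z` the
iterated Bochner integral is additive (`setIntegral_congr_fun`, `integral_add`), so the event lies in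
`{δ/2 < ∫∫f} ∪ {δ/2 < ∫∫g} ∪ {irregular}`; the last set is null (`ae_iff`); union bound; squeeze. -/
theorem tendsto_measure_sumEvent_of_channels {Z : ℕ → Type*} [∀ N, MeasurableSpace (Z N)]
    {X : Type*} [MeasureSpace X] (P : ∀ N, Measure (Z N)) (f g : ∀ N, Z N → ℝ → X → ℝ)
    (t δ : ℝ) (hδ : 0 < δ)
    (hreg : ∀ N, ∀ᵐ z ∂(P N), (∀ s ∈ Icc 0 t, Integrable (fun x => f N z s x)) ∧
      (∀ s ∈ Icc 0 t, Integrable (fun x => g N z s x)) ∧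
      IntegrableOn (fun s => ∫ x, f N z s x) (Icc 0 t) ∧ IntegrableOn (fun s => ∫ x, g N z s x) (Icc 0 t))
    (hf : ∀ δ' : ℝ, 0 < δ' →
      Tendsto (fun N => P N {z | δ' < ∫ s in Icc 0 t, ∫ x, f N z s x}) atTop (𝓝 0))
    (hg : ∀ δ' : ℝ, 0 < δ' →
      Tendsto (fun N => P N {z | δ' < ∫ s in Icc 0 t, ∫ x, g N z s x}) atTop (𝓝 0)) :
    Tendsto (fun N => P N {z | δ < ∫ s in Icc 0 t, ∫ x, (f N z s x + g N z s x)}) atTop (𝓝 0) := by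
  -- the regularity defect is a null set
  have hnull : ∀ N, P N {z | ¬ ((∀ s ∈ Icc 0 t, Integrable (fun x => f N z s x)) ∧
      (∀ s ∈ Icc 0 t, Integrable (fun x => g N z s x)) ∧
      IntegrableOn (fun s => ∫ x, f N z s x) (Icc 0 t) ∧
      IntegrableOn (fun s => ∫ x, g N z s x) (Icc 0 t))} = 0 :=
    fun N => ae_iff.1 (hreg N)
  -- the set inclusion: on a regular configuration the iterated integral splits
  have hsub : ∀ N, {z | δ < ∫ s in Icc 0 t, ∫ x, (f N z s x + g N z s x)} ⊆
      ({z | δ / 2 < ∫ s in Icc 0 t, ∫ x, f N z s x} ∪ {z | δ / 2 < ∫ s in Icc 0 t, ∫ x, g N z s x}) ∪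
        {z | ¬ ((∀ s ∈ Icc 0 t, Integrable (fun x => f N z s x)) ∧
          (∀ s ∈ Icc 0 t, Integrable (fun x => g N z s x)) ∧
          IntegrableOn (fun s => ∫ x, f N z s x) (Icc 0 t) ∧
          IntegrableOn (fun s => ∫ x, g N z s x) (Icc 0 t))} := by
    intro N z hz
    simp only [Set.mem_union, Set.mem_setOf_eq] at hz ⊢
    by_contra hcon
    push Not at hcon
    obtain ⟨⟨hA, hB⟩, hf1, hg1, hf2, hg2⟩ := hcon
    have h1 : ∫ s in Icc 0 t, ∫ x, (f N z s x + g N z s x) =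
        ∫ s in Icc 0 t, ((∫ x, f N z s x) + ∫ x, g N z s x) :=
      setIntegral_congr_fun measurableSet_Icc (fun s hs => integral_add (hf1 s hs) (hg1 s hs))
    rw [h1, integral_add hf2 hg2] at hz
    linarith
  -- union bound + squeeze
  have hf' := hf (δ / 2) (half_pos hδ)
  have hg' := hg (δ / 2) (half_pos hδ)
  have hsum := hf'.add hg'
  rw [add_zero] at hsum
  have hle : ∀ N, P N {z | δ < ∫ s in Icc 0 t, ∫ x, (f N z s x + g N z s x)} ≤
      P N {z | δ / 2 < ∫ s in Icc 0 t, ∫ x, f N z s x} +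
        P N {z | δ / 2 < ∫ s in Icc 0 t, ∫ x, g N z s x} := by
    intro N
    have step := ((measure_mono (hsub N)).trans (measure_union_le _ _)).trans
      (add_le_add (measure_union_le _ _) (hnull N).le)
    rw [add_zero] at step
    exact step
  exact tendsto_of_tendsto_of_tendsto_of_le_of_le tendsto_const_nhds hsum (fun N => zero_le) hle

/-! ## Composition: the three stubs give the crux BY NAME -/

/-- **`stub_blockFluxRegularity → stub_stressDeviatorRelaxation → stub_kineticHeatFluxRelaxation →
FastMomentRelaxation`** (hypotheses = the registered stub statements BY NAME; kernel-checked, no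
`sorry`): `σ₀ := min σ₀ᴰ σ₀^q`; instantiate the three stubs at the crux's profiles, `σ`, flow family,
kernel family and horizon, and apply `tendsto_measure_sumEvent_of_channels` with the laws
`N ↦ localGibbsLaw σ a₀ u₀ θ₀ N (Φ N)` and the two channel integrands `Σ_{jk} D_{jk}²`, `|q|²`; the crux's
`let`-bound block fields and the vocabulary `Dst`, `qfl` agree definitionally. -/
theorem FastMomentRelaxation_of (h₁ : stub_blockFluxRegularity) (h₂ : stub_stressDeviatorRelaxation)
    (h₃ : stub_kineticHeatFluxRelaxation) :
    Summit.AtomisticToContinuum.HydrodynamicLimit.Theses.StiffCollisionalRelaxation.FastMomentRelaxation := by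
  intro a₀ θ₀ u₀ ha hθ hu ha0 hθ0
  obtain ⟨σ₂, hσ₂, H2⟩ :=
    (h₂ : type_of% Holds.stub_stressDeviatorRelaxation) a₀ θ₀ u₀ ha hθ hu ha0 hθ0
  obtain ⟨σ₃, hσ₃, H3⟩ :=
    (h₃ : type_of% Holds.stub_kineticHeatFluxRelaxation) a₀ θ₀ u₀ ha hθ hu ha0 hθ0
  refine ⟨min σ₂ σ₃, lt_min hσ₂ hσ₃, ?_⟩
  intro σ hσ hσlt Φ γ C φ hγ hγle hφ ρb mb ub D q t ht δ hδ
  have H1' : ∀ N : ℕ, ∀ᵐ z ∂(localGibbsLaw σ a₀ u₀ θ₀ N (Φ N)),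
      (∀ s ∈ Icc 0 t, Integrable (fun x : T3 => ∑ j, ∑ k, Dst φ N ((Φ N).flow s z) x j k ^ 2)) ∧
      (∀ s ∈ Icc 0 t, Integrable (fun x : T3 => ‖qfl φ N ((Φ N).flow s z) x‖ ^ 2)) ∧
      IntegrableOn (fun s : ℝ => ∫ x, ∑ j, ∑ k, Dst φ N ((Φ N).flow s z) x j k ^ 2) (Icc 0 t) ∧
      IntegrableOn (fun s : ℝ => ∫ x, ‖qfl φ N ((Φ N).flow s z) x‖ ^ 2) (Icc 0 t) := fun N =>
    (h₁ : type_of% Holds.stub_blockFluxRegularity) σ Φ φ N (hφ.1 N).continuous (hφ.2.1 N) a₀ θ₀ u₀ t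
  have H2' := H2 σ hσ (hσlt.trans_le (min_le_left _ _)) Φ γ C φ hγ hγle hφ t ht
  have H3' := H3 σ hσ (hσlt.trans_le (min_le_right _ _)) Φ γ C φ hγ hγle hφ t ht
  exact tendsto_measure_sumEvent_of_channels
    (fun N => localGibbsLaw σ a₀ u₀ θ₀ N (Φ N))
    (fun N z s x => ∑ j, ∑ k, Dst φ N ((Φ N).flow s z) x j k ^ 2)
    (fun N z s x => ‖qfl φ N ((Φ N).flow s z) x‖ ^ 2) t δ hδ H1' H2' H3'

end Summit.AtomisticToContinuum.HydrodynamicLimit.Cruxes.FastMomentRelaxation.Birth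

end
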